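import Summits.BirchSwinnertonDyer.BirchSwinnertonDyer.Theorems.KolyvaginRoadThreeSchneiderTamAtThreeHeightLogNumeratorExactLaws
import HarnessLib

/-!
# Crux `SchneiderTamAtThree` (item 19154) — THE HEIGHT IS THE LOGARITHM OF THE NUMERATOR, DEEP POINTS,
# part 7d: THE CANONICAL 3-ADIC HEIGHT AS AN EXACT LIMIT OF NUMERATORS —
# `⟨P,P⟩ = lim_m 9^{−m}·log₃ num x(3^m P) − κ_E·log_E(P)²`

HONEST FRAMING (cell `bsd-stepL`, seat `bsd-stepL-tam3-p2` g3, WIDTH-LEVER second lane «closed-form Schneider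
local factor at 3 … finite case table proved once»; `--supports stmt-BirchSwinnertonDyer-19154 --as helper`):
THEOREMS ONLY, unconditional, route-independent (no Theses import); 0 definitions, 0 named facts, 0 sorry;
nothing here proves the crux `SchneiderTamAtThree`, Schneider's conjecture or BSD.

For `W/ℚ` globally minimal with multiplicative reduction at `3`, `q ∈ ℚ₃` with `‖q‖₃ < 1`, THE canonical datum `Dh`
(`IsMultCanonical Dh q`, Stein–Wuthrich §4.2) and an admissible rational point `P = (x, y)` (ANY level `k ≥ 1`),
write `ℓ = log_E(P) = (W/ℚ₃).padicFormalLog(−x/y)`, `κ_E = (C⁻²E₂(q) − b₂)/12` (part 7b) and `a_m = num x(3^m P)`.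
* §23 `padicFormalLog_param_nsmul` — `log_E(n·P) = n·log_E(P)` on admissible points (the tree's
  `padicFormalLog_param_add`, induction); `norm_padicFormalLog_param_eq` — `‖log_E(P)‖ = ‖z(P)‖`.
* §24 `norm_pairing_add_kappaE_mul_formalLog_sq_sub_le` — for every `m ≥ 1`:
  **`‖⟨P,P⟩ + κ_E·ℓ² − 9^{−m}·log₃ a_m‖₃ ≤ 3·9^{−m}·‖x‖₃⁻²`** (the exact law of part 7b at the admissible point
  `3^m P` of level `k + m`, bilinearity `⟨3^mP, 3^mP⟩ = 9^m⟨P,P⟩`, `log_E(3^mP) = 3^m ℓ` and `‖1/x(3^mP) − log_E(3^mP)²‖ ≤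
  3‖z(3^mP)‖⁴`).
* §25 `tendsto_numeratorTower` — **`9^{−m}·log₃ num x(3^m P) → ⟨P,P⟩ + κ_E·log_E(P)²`** in `ℚ₃`: THE canonical
  `3`-adic height is the `q`-FREE, `σ`-free arithmetic limit `N(P) = lim 9^{−m} log₃ num x(3^mP)` (the `3`-adic
  twin of `ĥ_∞ = lim 4^{−n} h(x(2ⁿP))`) MINUS the quasi-period term `κ_E·log_E(P)²`; all dependence on the Tate
  parameter sits in the single constant `κ_E`.
* §26 `pairing_self_eq_zero_iff_tendsto` — **`⟨P,P⟩ = 0 ⟺ 9^{−m} log₃ num x(3^mP) → κ_E·log_E(P)²`**: per pair the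
  crux's deciding statement says that the numerator tower of one admissible point does not converge to
  `κ_E·log_E(P)²` — decided at a finite `m` whenever false (part 7c §21); class-wide OPEN (transcendence-type,
  RULING 20 (A): blocked-on `Uniform.UI.O2.TateSigmaIrrationalAtThree`).

References: [SteinWuthrich2013] §4.1–4.2; [MazurSteinTate2006] §1 (heights via multiples in `E₁`);
[MazurTateTeitelbaum1986Invent] §II.4; [SilvermanAEC2009] IV.6.4, VII.2.2; tree: parts 7a–7c,
`SteinWuthrich2013/MultiplicativeHeightExistenceProofs` (`padicFormalLog_param_add`), `CanonicalPAdicHeightJunkSigmaProofs`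
(`isAdmissible_nsmul`).
-/

noncomputable section

open scoped Classical Nat
open Filter Topology IsUltrametricDist PowerSeries
open WeierstrassCurve Literature.NumberTheory.EllipticCurves
open Literature.NumberTheory.EllipticCurves.SteinWuthrich2013
open Literature.NumberTheory.EllipticCurves.TateCurve
open Literature.NumberTheory.EllipticCurves.Rank1Residual
open Summit.BirchSwinnertonDyer.Uniform.UI.O2

namespace Summit.BirchSwinnertonDyer.Rank1Residual.X11b.RegMult.HeightLogNumerator

/-! ### §23 The formal logarithm along multiples of an admissible point -/

section FormalLog

variable {W : WeierstrassCurve ℚ} {p : ℕ} [Fact p.Prime]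

/-- **`log_E(n·P) = n·log_E(P)`** for an admissible rational point `P = (x, y)` and `n ≥ 1`, in coordinates:
if `n • P = (x', y')` then `log_E(−x'/y') = n·log_E(−x/y)` (every multiple is admissible, in particular non-zero
and in `E₁(ℚ_p)`; induction on `n` with the tree's `padicFormalLog_param_add`).
[cite: SilvermanAEC2009, IV.6.4(a) and VII.2.2] [cite: MazurSteinTate2006, §1] -/
theorem padicFormalLog_param_nsmul [W.IsElliptic] [W.IsGloballyMinimal] {x y : ℚ}
    {h : W.toAffine.Nonsingular x y} (hadm : W.IsAdmissible p (.some x y h)) :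
    ∀ (n : ℕ), 1 ≤ n → ∀ {x' y' : ℚ} {h' : W.toAffine.Nonsingular x' y'},
      n • (.some x y h : W.toAffine.Point) = .some x' y' h' →
      (W.baseChange ℚ_[p]).padicFormalLog (-(x' : ℚ_[p]) / y') =
        (n : ℚ_[p]) * (W.baseChange ℚ_[p]).padicFormalLog (-(x : ℚ_[p]) / y) := by
  intro n hn
  induction n, hn using Nat.le_induction with
  | base =>
    intro x' y' h' h1
    rw [one_nsmul] at h1
    obtain ⟨rfl, rfl⟩ := (Affine.Point.some.injEq _ _ _ _ _ _).mp h1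
    rw [Nat.cast_one, one_mul]
  | succ n hn ih =>
    intro x' y' h' hS
    have hnadm : W.IsAdmissible p (n • (.some x y h : W.toAffine.Point)) :=
      isAdmissible_nsmul hadm (by omega)
    rcases hpt : n • (.some x y h : W.toAffine.Point) with _ | ⟨xn, yn, hn'⟩
    · rw [hpt] at hnadm; exact absurd hnadm (W.not_isAdmissible_zero p)
    · rw [hpt] at hnadm
      have hxn : 1 < ‖(xn : ℚ_[p])‖ := hnadm.2.1
      have hx : 1 < ‖(x : ℚ_[p])‖ := hadm.2.1
      rw [succ_nsmul, hpt] at hS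
      rw [padicFormalLog_param_add hn' h h' hxn hx hS, ih hpt, Nat.cast_succ]
      ring

/-- **`‖log_E(P)‖ = ‖z(P)‖`** for a rational point `P = (x, y)` with `‖x‖_p > 1` on a globally minimal `W`
(`‖z‖ ≤ p⁻¹`, `‖log_E z − z‖ ≤ 2‖z‖² < ‖z‖`; `p` odd or `p = 2` alike since `2‖z‖ ≤ 2/p ≤ 1` needs only `‖z‖ < 1/2`
— we assume `p ≠ 2` for the strict inequality). [cite: SilvermanAEC2009, IV.6.4 and VII.2.2] -/
theorem norm_padicFormalLog_param_eq [W.IsElliptic] [W.IsGloballyMinimal] (hp : p ≠ 2) {x y : ℚ}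
    (hxy : W.toAffine.Nonsingular x y) (hx : 1 < ‖(x : ℚ_[p])‖) :
    ‖(W.baseChange ℚ_[p]).padicFormalLog (-(x : ℚ_[p]) / y)‖ = ‖-(x : ℚ_[p]) / y‖ := by
  obtain ⟨hz, hz2⟩ := norm_neg_div_of_one_lt_norm (p := p) hxy hx
  set z : ℚ_[p] := -(x : ℚ_[p]) / y with hzdef
  have hzz : 0 < ‖z‖ := by
    have h : 0 < ‖z‖ ^ 2 := by rw [hz2]; exact inv_pos.mpr (one_pos.trans hx)
    rcases (norm_nonneg z).eq_or_lt with h0 | h0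
    · rw [← h0] at h; norm_num at h
    · exact h0
  have hp3 : (3 : ℝ) ≤ p := by
    have h2 := (Fact.out : p.Prime).two_le
    have : p ≠ 2 := hp
    exact_mod_cast (by omega : 3 ≤ p)
  have hw := norm_padicFormalLog_sub_self_le_two_mul_sq (W.baseChange ℚ_[p]) hz
  have hlt : ‖(W.baseChange ℚ_[p]).padicFormalLog z - z‖ < ‖z‖ := by
    refine lt_of_le_of_lt hw ?_
    have hzp : ‖z‖ ≤ 1 / 3 := hz.trans (by rw [one_div]; exact inv_anti₀ (by norm_num) hp3)
    calc 2 * ‖z‖ ^ 2 = (2 * ‖z‖) * ‖z‖ := by ring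
      _ ≤ (2 * (1 / 3)) * ‖z‖ := by gcongr
      _ < 1 * ‖z‖ := mul_lt_mul_of_pos_right (by norm_num) hzz
      _ = ‖z‖ := one_mul _
  rw [show (W.baseChange ℚ_[p]).padicFormalLog z = z + ((W.baseChange ℚ_[p]).padicFormalLog z - z) by ring,
    norm_add_eq_max_of_norm_ne_norm hlt.ne', max_eq_left hlt.le]

end FormalLog

/-! ### §24 The exact law along the `3`-power tower -/

section Tower

variable {W : WeierstrassCurve ℚ}

/-- **THE canonical height from the numerators of the `3`-power multiples.** For `W/ℚ` globally minimal with
multiplicative reduction at `3`, `‖q‖₃ < 1`, `IsMultCanonical Dh q`, an admissible rational point `P = (x, y)`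
(any level `k ≥ 1`) and `m ≥ 1` with `3^m • P = (x', y')`:
**`‖⟨P,P⟩ + κ_E·log_E(P)² − 9^{−m}·log₃ num x'‖₃ ≤ 3·9^{−m}·‖x‖₃⁻²`** (`= 3^{1 − 4k − 2m}`).
Ingredients: `3^m P` is admissible of level `k + m` (`log_E(3^mP) = 3^m log_E(P)`, `‖log_E‖ = ‖z‖`); the exact law
(part 7b/7c §20) at `3^m P`; `⟨3^mP,3^mP⟩ = 9^m⟨P,P⟩`; `‖1/x' − log_E(3^mP)²‖ ≤ 3‖z'‖⁴` (part 6); `‖κ_E‖ ≤ 1`.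
[cite: SteinWuthrich2013, §4.1 eq. (4.1), §4.2] [cite: MazurSteinTate2006, §1] [cite: MazurTateTeitelbaum1986Invent, §II.4] -/
theorem norm_pairing_add_kappaE_mul_formalLog_sq_sub_le [W.IsElliptic] [W.IsGloballyMinimal]
    (hW : Mult W 3) {q : ℚ_[3]} (hq : ‖q‖ < 1) {Dh : PAdicHeightData W 3} (hDh : IsMultCanonical Dh q)
    {x y : ℚ} {h : W.toAffine.Nonsingular x y} (hadm : W.IsAdmissible 3 (.some x y h))
    {m : ℕ} (hm : 1 ≤ m) {x' y' : ℚ} {h' : W.toAffine.Nonsingular x' y'}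
    (hmP : 3 ^ m • (.some x y h : W.toAffine.Point) = .some x' y' h') :
    ‖Dh.pairing (.some x y h) (.some x y h) +
        ((uniformisationScaleSq W 3 q)⁻¹ * (1 - 24 * tateS 1 q) - (W.baseChange ℚ_[3]).b₂) / 12 *
          (W.baseChange ℚ_[3]).padicFormalLog (-(x : ℚ_[3]) / y) ^ 2 -
        ((9 : ℚ_[3]) ^ m)⁻¹ * padicLog 3 ((x'.num : ℚ) : ℚ_[3])‖
      ≤ 3 * ((9 : ℝ) ^ m)⁻¹ * ‖(x : ℚ_[3])‖⁻¹ ^ 2 := by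
  set V : WeierstrassCurve ℚ_[3] := W.baseChange ℚ_[3] with hVdef
  set κ : ℚ_[3] := ((uniformisationScaleSq W 3 q)⁻¹ * (1 - 24 * tateS 1 q) - V.b₂) / 12 with hκdef
  set X : ℚ_[3] := (x : ℚ_[3]) with hXdef
  set X' : ℚ_[3] := (x' : ℚ_[3]) with hX'def
  set z : ℚ_[3] := -X / (y : ℚ_[3]) with hzdef
  set z' : ℚ_[3] := -X' / (y' : ℚ_[3]) with hz'def
  set ℓ : ℚ_[3] := V.padicFormalLog z with hℓdef
  set ℓ' : ℚ_[3] := V.padicFormalLog z' with hℓ'def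
  obtain ⟨h2n, h4n, h3n, h3i, h9i, h12i, -, -, -, -⟩ := padic_three_constants
  -- admissibility and norms of `P` and `P' = 3^m P`
  have h3m0 : (3 : ℕ) ^ m ≠ 0 := pow_ne_zero m (by norm_num)
  have hadm' : W.IsAdmissible 3 (.some x' y' h') := by
    have h := isAdmissible_nsmul hadm h3m0; rwa [hmP] at h
  have hx : 1 < ‖X‖ := hadm.2.1
  have hx' : 1 < ‖X'‖ := hadm'.2.1
  obtain ⟨hz3, hz2⟩ := norm_neg_div_of_one_lt_norm (p := 3) h hx
  obtain ⟨hz3', hz2'⟩ := norm_neg_div_of_one_lt_norm (p := 3) h' hx'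
  rw [← hXdef, ← hzdef] at hz3 hz2
  rw [← hX'def, ← hz'def] at hz3' hz2'
  have hX0 : 0 < ‖X‖ := one_pos.trans hx
  have hX0' : X ≠ 0 := norm_pos_iff.mp hX0
  have hX'0 : 0 < ‖X'‖ := one_pos.trans hx'
  have hX'0' : X' ≠ 0 := norm_pos_iff.mp hX'0
  have hzz : 0 < ‖z‖ := by
    have hh : 0 < ‖z‖ ^ 2 := by rw [hz2]; exact inv_pos.mpr hX0
    rcases (norm_nonneg z).eq_or_lt with h0 | h0
    · rw [← h0] at hh; norm_num at hh
    · exact h0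
  -- `log_E(3^m P) = 3^m log_E(P)`, `‖log_E‖ = ‖z‖`
  have hℓmul : ℓ' = ((3 ^ m : ℕ) : ℚ_[3]) * ℓ := padicFormalLog_param_nsmul (p := 3) hadm (3 ^ m)
    (Nat.one_le_iff_ne_zero.mpr h3m0) hmP
  have hℓn : ‖ℓ‖ = ‖z‖ := norm_padicFormalLog_param_eq (p := 3) (by norm_num) h hx
  have hℓ'n : ‖ℓ'‖ = ‖z'‖ := norm_padicFormalLog_param_eq (p := 3) (by norm_num) h' hx'
  have h3mn : ‖((3 ^ m : ℕ) : ℚ_[3])‖ = ((3 : ℝ) ^ m)⁻¹ := by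
    rw [Nat.cast_pow, norm_pow, show ((3 : ℕ) : ℚ_[3]) = ((3 : ℕ) : ℚ_[3]) from rfl, Padic.norm_p, inv_pow]
    norm_num
  have hzrel : ‖z'‖ = ((3 : ℝ) ^ m)⁻¹ * ‖z‖ := by rw [← hℓ'n, hℓmul, norm_mul, h3mn, hℓn]
  have hXrel : ‖X'‖⁻¹ = ((9 : ℝ) ^ m)⁻¹ * ‖X‖⁻¹ := by
    rw [← hz2', ← hz2, hzrel, mul_pow, inv_pow, ← pow_mul, show (3 : ℝ) ^ (m * 2) = 9 ^ m by
      rw [mul_comm, pow_mul]; norm_num]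
  -- level of `3^m P` is `≥ 2`
  have hz9' : ‖z'‖ ≤ 1 / 9 := by
    rw [hzrel]
    have h3 : ((3 : ℝ) ^ m)⁻¹ ≤ 3⁻¹ := by
      apply inv_anti₀ (by norm_num)
      calc (3 : ℝ) = 3 ^ 1 := (pow_one _).symm
        _ ≤ 3 ^ m := pow_le_pow_right₀ (by norm_num) hm
    calc ((3 : ℝ) ^ m)⁻¹ * ‖z‖ ≤ 3⁻¹ * 3⁻¹ := mul_le_mul h3 (hz3.trans (by norm_num)) (norm_nonneg _) (by norm_num)
      _ = 1 / 9 := by norm_num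
  -- the exact law at `3^m P` (part 7b), for THE datum: `⟨P',P'⟩ = ĥ₃(P')`
  have hlaw : ‖heightFourOneCoord W 3 q x' y' - padicLog 3 ((x'.num : ℚ) : ℚ_[3]) +
      κ * (((x'.den : ℚ) : ℚ_[3]) / ((x'.num : ℚ) : ℚ_[3]))‖ ≤ ‖X'‖⁻¹ ^ 2 :=
    norm_heightFourOneCoord_sub_padicLog_num_add_kappaE_mul_le hW hq h' hx' hz9'
  have hpair' : Dh.pairing (.some x' y' h') (.some x' y' h') = heightFourOneCoord W 3 q x' y' := by
    rw [hDh _ hadm', heightFourOne_some]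
  have hsq : Dh.pairing (.some x' y' h') (.some x' y' h') =
      ((3 ^ m : ℕ) : ℚ_[3]) ^ 2 * Dh.pairing (.some x y h) (.some x y h) := by
    rw [← hmP, map_nsmul, map_nsmul, AddMonoidHom.nsmul_apply, smul_smul, nsmul_eq_mul]
    push_cast; ring
  -- `den/num = 1/x'`, `‖1/x' − ℓ'²‖ ≤ 3‖z'‖⁴`
  have hnum : ((x'.num : ℚ) : ℚ_[3]) = X' * ((x'.den : ℚ) : ℚ_[3]) := by
    rw [hX'def, ← Rat.cast_mul, Rat.mul_den_eq_num]
  have hd0 : ((x'.den : ℚ) : ℚ_[3]) ≠ 0 := by exact_mod_cast x'.den_nz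
  have hDa : ((x'.den : ℚ) : ℚ_[3]) / ((x'.num : ℚ) : ℚ_[3]) = X'⁻¹ := by
    rw [hnum]; field_simp
  have heq' : V.toAffine.Equation X' (y' : ℚ_[3]) := (nonsingular_ratCast (p := 3) h').left
  obtain ⟨hb2n, hb4n⟩ : ‖V.b₂‖ ≤ 1 ∧ ‖V.b₄‖ ≤ 1 := by
    have hI := V.eq_map_integralModel
    refine ⟨?_, ?_⟩
    · have e := congrArg WeierstrassCurve.b₂ hI
      rw [map_b₂] at e; rw [← e]; exact PadicInt.norm_le_one _
    · have e := congrArg WeierstrassCurve.b₄ hI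
      rw [map_b₄] at e; rw [← e]; exact PadicInt.norm_le_one _
  have hXi2' : ‖X'⁻¹‖ = ‖z'‖ ^ 2 := by rw [norm_inv, hz2']
  have hzz' : 0 < ‖z'‖ := by rw [hzrel]; positivity
  have hXℓ' : ‖X' * ℓ' ^ 2 - 1 + V.b₂ / 12 * ℓ' ^ 2 - (V.b₂ ^ 2 - 24 * V.b₄) / 240 * ℓ' ^ 4‖ ≤ ‖z'‖ ^ 4 := by
    have hh := norm_x_mul_formalLog_sq_sub_le V heq' hx' hz9'
    rw [← hz2'] at hh
    exact hh.trans_eq (by ring)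
  have hℓX : ‖ℓ' ^ 2 - X'⁻¹‖ ≤ 3 * ‖z'‖ ^ 4 :=
    norm_formalLog_sq_sub_inv_le hX'0' hXi2' hℓ'n hzz' hz9' hb2n hb4n hXℓ'
  have hκ : ‖κ‖ ≤ 1 := norm_kappaE_le_one hW hq
  -- assemble at level `3^m P`
  have h9 : ((3 ^ m : ℕ) : ℚ_[3]) ^ 2 = (9 : ℚ_[3]) ^ m := by push_cast; rw [← pow_mul, mul_comm, pow_mul]; norm_num
  have h9n : ‖((9 : ℚ_[3]) ^ m)⁻¹‖ = (9 : ℝ) ^ m := by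
    have h9' : ‖(9 : ℚ_[3])‖ = 9⁻¹ := by
      rw [show (9 : ℚ_[3]) = 3 * 3 by norm_num, norm_mul, h3n]; norm_num
    rw [norm_inv, norm_pow, h9', inv_pow, inv_inv]
  have h90 : (9 : ℚ_[3]) ^ m ≠ 0 := pow_ne_zero m (by norm_num)
  have hmain : ‖(9 : ℚ_[3]) ^ m * (Dh.pairing (.some x y h) (.some x y h) + κ * ℓ ^ 2) -
      padicLog 3 ((x'.num : ℚ) : ℚ_[3])‖ ≤ 3 * ‖z'‖ ^ 4 := by
    have e : (9 : ℚ_[3]) ^ m * (Dh.pairing (.some x y h) (.some x y h) + κ * ℓ ^ 2) -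
        padicLog 3 ((x'.num : ℚ) : ℚ_[3]) =
        (heightFourOneCoord W 3 q x' y' - padicLog 3 ((x'.num : ℚ) : ℚ_[3]) +
          κ * (((x'.den : ℚ) : ℚ_[3]) / ((x'.num : ℚ) : ℚ_[3]))) + κ * (ℓ' ^ 2 - X'⁻¹) := by
      rw [hDa, ← hpair', hsq, h9, hℓmul, mul_pow, h9]; ring
    rw [e]
    refine (norm_add_le_max _ _).trans (max_le (hlaw.trans ?_) ?_)
    · rw [← hz2']
      calc (‖z'‖ ^ 2) ^ 2 = 1 * ‖z'‖ ^ 4 := by ring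
        _ ≤ 3 * ‖z'‖ ^ 4 := by gcongr; norm_num
    · rw [norm_mul]
      calc ‖κ‖ * ‖ℓ' ^ 2 - X'⁻¹‖ ≤ 1 * (3 * ‖z'‖ ^ 4) := by gcongr
        _ = 3 * ‖z'‖ ^ 4 := one_mul _
  -- divide by `9^m`
  have e2 : Dh.pairing (.some x y h) (.some x y h) + κ * ℓ ^ 2 -
      ((9 : ℚ_[3]) ^ m)⁻¹ * padicLog 3 ((x'.num : ℚ) : ℚ_[3]) =
      ((9 : ℚ_[3]) ^ m)⁻¹ * ((9 : ℚ_[3]) ^ m * (Dh.pairing (.some x y h) (.some x y h) + κ * ℓ ^ 2) -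
        padicLog 3 ((x'.num : ℚ) : ℚ_[3])) := by
    field_simp
  rw [e2, norm_mul, h9n]
  have hz4 : ‖z'‖ ^ 4 = ((9 : ℝ) ^ m)⁻¹ ^ 2 * ‖X‖⁻¹ ^ 2 := by
    rw [show ‖z'‖ ^ 4 = (‖z'‖ ^ 2) ^ 2 by ring, hz2', hXrel, mul_pow]
  calc (9 : ℝ) ^ m * ‖(9 : ℚ_[3]) ^ m * (Dh.pairing (.some x y h) (.some x y h) + κ * ℓ ^ 2) -
        padicLog 3 ((x'.num : ℚ) : ℚ_[3])‖ ≤ (9 : ℝ) ^ m * (3 * ‖z'‖ ^ 4) := by gcongr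
    _ = 3 * ((9 : ℝ) ^ m)⁻¹ * ‖X‖⁻¹ ^ 2 := by rw [hz4]; field_simp

end Tower

/-! ### §25 The limit: `⟨P,P⟩ = N(P) − κ_E·log_E(P)²`, `N(P) = lim 9^{−m} log₃ num x(3^m P)` -/

section Limit

variable {W : WeierstrassCurve ℚ}

/-- **THE CANONICAL `3`-ADIC HEIGHT AS AN EXACT LIMIT.** For `W/ℚ` globally minimal with multiplicative
reduction at `3`, `‖q‖₃ < 1`, THE canonical datum `Dh` (`IsMultCanonical Dh q`) and an admissible rational point
`P = (x, y)`: the «numerator tower» `9^{−m}·log₃ num x(3^m P)` CONVERGES in `ℚ₃`, to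
**`⟨P,P⟩ + κ_E·log_E(P)²`** (`κ_E = (C⁻²E₂(q) − b₂)/12`). Equivalently `⟨P,P⟩ = N(P) − κ_E·log_E(P)²` with
`N(P) := lim_m 9^{−m} log₃ num x(3^m P)` a `q`-free, `σ`-free arithmetic invariant of `(E, P)`: the Tate
parameter enters THE height only through the constant `κ_E`. [cite: SteinWuthrich2013, §4.1 eq. (4.1), §4.2]
[cite: MazurSteinTate2006, §1] [cite: MazurTateTeitelbaum1986Invent, §II.4] -/
theorem tendsto_numeratorTower [W.IsElliptic] [W.IsGloballyMinimal] (hW : Mult W 3) {q : ℚ_[3]}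
    (hq : ‖q‖ < 1) {Dh : PAdicHeightData W 3} (hDh : IsMultCanonical Dh q) {x y : ℚ}
    {h : W.toAffine.Nonsingular x y} (hadm : W.IsAdmissible 3 (.some x y h)) :
    Tendsto (fun m : ℕ ↦ ((9 : ℚ_[3]) ^ m)⁻¹ *
        padicLog 3 (((W.xCoord (3 ^ m • (.some x y h : W.toAffine.Point))).num : ℚ) : ℚ_[3]))
      atTop (𝓝 (Dh.pairing (.some x y h) (.some x y h) +
        ((uniformisationScaleSq W 3 q)⁻¹ * (1 - 24 * tateS 1 q) - (W.baseChange ℚ_[3]).b₂) / 12 *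
          (W.baseChange ℚ_[3]).padicFormalLog (-(x : ℚ_[3]) / y) ^ 2)) := by
  set T : ℚ_[3] := Dh.pairing (.some x y h) (.some x y h) +
    ((uniformisationScaleSq W 3 q)⁻¹ * (1 - 24 * tateS 1 q) - (W.baseChange ℚ_[3]).b₂) / 12 *
      (W.baseChange ℚ_[3]).padicFormalLog (-(x : ℚ_[3]) / y) ^ 2 with hTdef
  rw [tendsto_iff_norm_sub_tendsto_zero]
  have hB : Tendsto (fun m : ℕ ↦ 3 * ((9 : ℝ) ^ m)⁻¹ * ‖(x : ℚ_[3])‖⁻¹ ^ 2) atTop (𝓝 0) := by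
    have h0 : Tendsto (fun m : ℕ ↦ ((9 : ℝ)⁻¹) ^ m) atTop (𝓝 0) :=
      tendsto_pow_atTop_nhds_zero_of_lt_one (by norm_num) (by norm_num)
    have := (h0.const_mul 3).mul_const (‖(x : ℚ_[3])‖⁻¹ ^ 2)
    simpa only [inv_pow, mul_zero, zero_mul] using this
  refine squeeze_zero' (Eventually.of_forall fun m ↦ norm_nonneg _) ?_ hB
  rw [Filter.eventually_atTop]
  refine ⟨1, fun m hm ↦ ?_⟩
  have hadm' : W.IsAdmissible 3 (3 ^ m • (.some x y h : W.toAffine.Point)) :=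
    isAdmissible_nsmul hadm (pow_ne_zero m (by norm_num))
  rcases hpt : 3 ^ m • (.some x y h : W.toAffine.Point) with _ | ⟨x', y', h'⟩
  · rw [hpt] at hadm'; exact absurd hadm' (W.not_isAdmissible_zero 3)
  · rw [xCoord_some, norm_sub_rev]
    exact norm_pairing_add_kappaE_mul_formalLog_sq_sub_le hW hq hDh hadm hm hpt

/-- **`⟨P,P⟩ = 0 ⟺` the numerator tower converges to `κ_E·log_E(P)²`.** (Uniqueness of limits in `ℚ₃`.)
Per pair, the crux's deciding statement (`⟨P,P⟩ ≠ 0` for THE datum) is thus the failure of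
`9^{−m} log₃ num x(3^m P) → κ_E·log_E(P)²`, detected at a finite `m` whenever it fails (part 7c §21, §22);
class-wide it is open. [cite: SteinWuthrich2013, §4.1 eq. (4.1), §4.2] [cite: Schneider1982PadicHeightI, §1] -/
theorem pairing_self_eq_zero_iff_tendsto [W.IsElliptic] [W.IsGloballyMinimal] (hW : Mult W 3) {q : ℚ_[3]}
    (hq : ‖q‖ < 1) {Dh : PAdicHeightData W 3} (hDh : IsMultCanonical Dh q) {x y : ℚ}
    {h : W.toAffine.Nonsingular x y} (hadm : W.IsAdmissible 3 (.some x y h)) :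
    Dh.pairing (.some x y h) (.some x y h) = 0 ↔
      Tendsto (fun m : ℕ ↦ ((9 : ℚ_[3]) ^ m)⁻¹ *
          padicLog 3 (((W.xCoord (3 ^ m • (.some x y h : W.toAffine.Point))).num : ℚ) : ℚ_[3]))
        atTop (𝓝 (((uniformisationScaleSq W 3 q)⁻¹ * (1 - 24 * tateS 1 q) - (W.baseChange ℚ_[3]).b₂) / 12 *
          (W.baseChange ℚ_[3]).padicFormalLog (-(x : ℚ_[3]) / y) ^ 2)) := by
  have hT := tendsto_numeratorTower hW hq hDh hadm
  constructor
  · intro h0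
    rw [h0, zero_add] at hT
    exact hT
  · intro hT'
    have heq := tendsto_nhds_unique hT hT'
    linear_combination heq

end Limit

end Summit.BirchSwinnertonDyer.Rank1Residual.X11b.RegMult.HeightLogNumerator

end
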